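import Summits.QuantumFields.YangMills.Theorems.BalabanUVNodesN16CentreConventionAllDepths
import Summits.QuantumFields.YangMills.Theorems.BalabanUVNodesN16SlotKeyGaugeQuotient
import HarnessLib

/-!
# YM-DAG node N16 (NE3), the located averaging pin (42) ↔ (0.4) — part 20: THE RE-KEYED N07 IN-EDGE (SLOT KEY (T9ˢ) ∧ (T8)) DOES NOT SEE THE CONVENTION —
# it is an invariant of the coarse-gauge-equivalence class of the constraint's averaging scheme; instance: (43) ⟺ the centre-convention torus (42) `cstep` ⟺ the
# guarded corner (42), at every depth, in the (8)-radius regime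

Cell `pub-ymgap`, width seat `pub-ymgap-dag-n16-w3` (director-ym №197 ∕ HUMAN RULING D-0149), generation 7; part 20 of the W1b lineage (part 14 p616704 `SchemeGaugeEquiv`; part 15
p620271 `forall_isMinimiserS_iff_of_schemeGaugeEquiv`; part 16 p622848 `schemeGaugeEquiv_step42_cstep ∕ _gbstep` at every depth) OVER dag-n16-w2 g5's
`…N16SlotKeyGaugeQuotient` (p621501: ★ `regularity_torusVP_lipGauge_gaugeAct_iff` — r2's `B11.Regularity` for leaf-06's torus instance at dag-n16-w1's shape `lipGauge` is
GAUGE INVARIANT).  `--kind proof --supports stmt-QuantumFields-27366 --as helper` (K3⁸ `SpineGivenEndpointR13SepCoPHV`, KEY MAP v2; lineage of K3⁷ 20544; count-neutral; 0 `def`).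
`bears_on: R4∕N16 · edge N07 → N16`.

THE POINT.  g6's HANDOFF left: «gauge invariance of leaf-06's `B11.Regularity (torusVP …)` (slot-key shapes) — not checked; with it, part 15 §3 transfers the slot key (T9ˢ)∕(T8)
between gauge-equivalent schemes».  dag-n16-w2 g5 has since supplied exactly that invariance.  Hence, for EVERY block of constants `C : B11Thm1.Consts` and every
(`k`, `ε₁`)-indexed family of data sets `D k ε₁` (the slot key's is `sfClass d L T ε₁ 0`):
 * §1 (any scheme `s` with `SchemeGaugeEquiv d (step42) s L T (k+1) (sfClass d L T (C.B₃ε₁) (k+1))` for all `k` and all `0 < ε₁ ≤ C.a₁`): ★★ `reg910Slot_iff_of_schemeGaugeEquiv`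
   — the slot key's regularity clause (T9ˢ) «every `s`-constrained (8)-class minimiser at a datum of `D k ε₁` is (9)–(10)-regular at `lipGauge` on the collar-slot cubes» holds
   iff the same for the (43)-constrained minimisers (`MinimalActionSandwich.IsMinimiser`); ★ `exists8_iff_of_schemeGaugeEquiv` — likewise the existence clause (T8).
 * §2 THE INSTANCE (part 16): if the block's largest class radius is in the (8)-radius regime (`16C₀(d)·B₃a₁ ≤ 3`, `1024(d+1)(d+4)L²·B₃a₁ ≤ 1` — WLOG by shrinking `a₁`,
   which only weakens Theorem-1-type keys), then ★★ `reg910Slot_cstep_iff` ∕ `exists8_cstep_iff`: (T9ˢ) and (T8) for the minimisers constrained by the centre-convention torus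
   (42) `cstep` ⟺ for the (43)-constrained ones; `reg910Slot_gbstep_iff` ∕ `exists8_gbstep_iff`: the same for row NE7's guarded corner (42).
READING (honest).  Node N07's content as N16 consumes it (the slot key, dag-n16-w1 files 9–14, dag-n16-w2 p620000∕p621501) is a statement about the COARSE-GAUGE-EQUIVALENCE
CLASS of the averaging scheme: (43), the guarded corner (42) and the tree's NE7 torus instance `avgB7` in Setup's centred convention carry literally equivalent keys.  Nothing
is said about the averaging of record (0.4) (`step04`), whose equivalence to (43) is NOT established (part 18's trace test is the handle).

HONEST FRAMING.  [folklore] bookkeeping BY NAME over parts 15∕16, g0's `isMinimiserS_step42_iff`, dag-n16-w2's `regularity_torusVP_lipGauge_gaugeAct_iff`, `NE3ResidualSliceRep.mem_sfClass_gaugeAct`;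
0 `def`, 0 `sorry`; no minimiser constructed; nothing of [Balaban1985Variational] asserted or refuted; the content of the in-edge ((9)–(10) at the (42)-objects) untouched;
`stub_reg910Slot` ∕ K3⁸ stubs NOT touched; N16 ∕ N07 NOT discharged; count-neutral (typed 28∕28 · discharged 5∕27 work-bound, A 5∕28 — unmoved).  One finite four-torus
programme at fixed `ε` — the Yang–Mills mass gap (Clay) is NOT proved by any of this; R4 closes the conditional finite-𝕋⁴ rung `BalabanLadder.UV` only; nothing continuum ∕ ℝ⁴ ∕ OS.
-/

set_option autoImplicit false

open scoped BigOperators Matrix Matrix.Norms.L2Operator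
open NormedSpace

namespace Summit.QuantumFields.YangMills.BalabanUVNodes.N16SlotKeySchemeInvariance

open Literature.MathematicalPhysics.QuantumFieldTheory.Balaban1983to89
open B7Prop1Explicit B7Prop2Explicit
open Summit.QuantumFields.BalabanUV.T4Continuum
open MinimalActionSandwich (IsMinimiser)
open MinimalActionRate (sfClass)
open MinimalActionDictionary (torusVP)
open NE3EnergyShapes (IsUnitarySite IsPeriodicSite)
open NE3ResidualSliceRep (mem_sfClass_gaugeAct)
open B11 (Regularity)
open Summit.QuantumFields.YangMills.BalabanUVNodes.N16AveragingPin (avgIterS step42 IsMinimiserS isMinimiserS_step42_iff)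
open Summit.QuantumFields.YangMills.BalabanUVNodes.N16CentreConventionTransfer (SchemeGaugeEquiv)
open Summit.QuantumFields.YangMills.BalabanUVNodes.N16CentreConventionDepthOne (forall_isMinimiserS_iff_of_schemeGaugeEquiv exists_isMinimiserS_iff_of_schemeGaugeEquiv)
open Summit.QuantumFields.YangMills.BalabanUVNodes.N16CentreConventionAllDepths (schemeGaugeEquiv_step42_cstep schemeGaugeEquiv_step42_gbstep)
open Summit.QuantumFields.YangMills.BalabanUVNodes.N16H7OfN07RecordSlot (lipGauge)
open Summit.QuantumFields.YangMills.BalabanUVNodes.N16SlotKeyGaugeQuotient (regularity_torusVP_lipGauge_gaugeAct_iff)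
open Summit.QuantumFields.BalabanUV.T4Continuum.Spine.NE7.TorusB7 (Mat gb cstep)

noncomputable section

/-! ## §1 The slot key's two clauses transfer between gauge-equivalent schemes -/

section Schemes

variable {d : ℕ} {n : Type} [Fintype n] [DecidableEq n] [Nonempty n]
variable {s : ℕ → (Site d → Fin d → (Matrix n n ℂ)ˣ) → (Site d → Fin d → (Matrix n n ℂ)ˣ)} {L T : ℕ}

/-- **★★ (T9ˢ) DOES NOT SEE THE SCHEME**: if `s` is pointwise coarse-gauge equivalent to (43) (block-lift covariance) at every depth `k+1` on the (8)-classes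
`sfClass d L T (B₃ε₁) (k+1)`, `0 < ε₁ ≤ a₁`, then the slot key's regularity clause — (9)–(10) at dag-n16-w1's shape `lipGauge` on the collar-slot cubes for EVERY
`s`-constrained (8)-class minimiser at the data of `D k ε₁` — holds iff it holds for every (43)-constrained minimiser (the tree's `IsMinimiser`): part 15
`forall_isMinimiserS_iff_of_schemeGaugeEquiv` at `Q U := ∀ x, Regularity …`, gauge invariant by dag-n16-w2's `regularity_torusVP_lipGauge_gaugeAct_iff`.
[cite: Balaban1985Variational, Thm 1 (9)–(10) p.279] -/
theorem reg910Slot_iff_of_schemeGaugeEquiv (hL : 1 ≤ L) (C : B11Thm1.Consts) (D : ℕ → ℝ → Set (Site d → Fin d → (Matrix n n ℂ)ˣ))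
    (hE : ∀ (k : ℕ) (ε₁ : ℝ), 0 < ε₁ → ε₁ ≤ C.a₁ → SchemeGaugeEquiv d (fun _ => step42 L) s L T (k + 1) (sfClass d L T (C.B₃ * ε₁) (k + 1))) :
    (∀ (k : ℕ) (ε₁ : ℝ), 0 < ε₁ → ε₁ ≤ C.a₁ → ∀ (V U : Site d → Fin d → (Matrix n n ℂ)ˣ), V ∈ D k ε₁ →
      IsMinimiserS d s (sfClass d L T (C.B₃ * ε₁)) L T (k + 1) V U →
        ∀ x : Site d, Regularity (torusVP d L T (lipGauge d n) (k + 1)) C.B₃ C.B₄ ε₁ U (x, L ^ (k + 1) - 1 + L ^ (k + 1) + 2)) ↔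
    (∀ (k : ℕ) (ε₁ : ℝ), 0 < ε₁ → ε₁ ≤ C.a₁ → ∀ (V U : Site d → Fin d → (Matrix n n ℂ)ˣ), V ∈ D k ε₁ →
      IsMinimiser d (sfClass d L T (C.B₃ * ε₁)) L T (k + 1) V U →
        ∀ x : Site d, Regularity (torusVP d L T (lipGauge d n) (k + 1)) C.B₃ C.B₄ ε₁ U (x, L ^ (k + 1) - 1 + L ^ (k + 1) + 2)) := by
  refine forall_congr' fun k => forall_congr' fun ε₁ => forall_congr' fun hε₁ => forall_congr' fun hε₁a => ?_
  have key := forall_isMinimiserS_iff_of_schemeGaugeEquiv (𝒞 := sfClass d L T (C.B₃ * ε₁)) hL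
    (fun u U hu huP hU => mem_sfClass_gaugeAct hu huP hU) (hE k ε₁ hε₁ hε₁a)
    (Q := fun U => ∀ x : Site d, Regularity (torusVP d L T (lipGauge d n) (k + 1)) C.B₃ C.B₄ ε₁ U (x, L ^ (k + 1) - 1 + L ^ (k + 1) + 2))
    (fun u U hu _ h x => (regularity_torusVP_lipGauge_gaugeAct_iff hu L T (k + 1) C.B₃ C.B₄ ε₁ U x _).mp (h x)) (D k ε₁)
  constructor
  · intro h V U hV hU
    exact key.1 (fun V hV U hU => h V U hV hU) V hV U ((isMinimiserS_step42_iff L _ T (k + 1) V U).2 hU)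
  · intro h V U hV hU
    exact key.2 (fun V hV U hU => h V U hV ((isMinimiserS_step42_iff L _ T (k + 1) V U).1 hU)) V hV U hU

/-- **★ (T8) DOES NOT SEE THE SCHEME**: under the same equivalence, «every datum of `D k ε₁` has an `s`-constrained (8)-class minimiser» iff «… a (43)-constrained one»
(part 15 `exists_isMinimiserS_iff_of_schemeGaugeEquiv`). [cite: Balaban1985Variational, Thm 1 (8) p.279] -/
theorem exists8_iff_of_schemeGaugeEquiv (hL : 1 ≤ L) (C : B11Thm1.Consts) (D : ℕ → ℝ → Set (Site d → Fin d → (Matrix n n ℂ)ˣ))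
    (hE : ∀ (k : ℕ) (ε₁ : ℝ), 0 < ε₁ → ε₁ ≤ C.a₁ → SchemeGaugeEquiv d (fun _ => step42 L) s L T (k + 1) (sfClass d L T (C.B₃ * ε₁) (k + 1))) :
    (∀ (k : ℕ) (ε₁ : ℝ), 0 < ε₁ → ε₁ ≤ C.a₁ → ∀ V : Site d → Fin d → (Matrix n n ℂ)ˣ, V ∈ D k ε₁ →
      ∃ U : Site d → Fin d → (Matrix n n ℂ)ˣ, IsMinimiserS d s (sfClass d L T (C.B₃ * ε₁)) L T (k + 1) V U) ↔
    (∀ (k : ℕ) (ε₁ : ℝ), 0 < ε₁ → ε₁ ≤ C.a₁ → ∀ V : Site d → Fin d → (Matrix n n ℂ)ˣ, V ∈ D k ε₁ →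
      ∃ U : Site d → Fin d → (Matrix n n ℂ)ˣ, IsMinimiser d (sfClass d L T (C.B₃ * ε₁)) L T (k + 1) V U) := by
  refine forall_congr' fun k => forall_congr' fun ε₁ => forall_congr' fun hε₁ => forall_congr' fun hε₁a =>
    forall_congr' fun V => forall_congr' fun _ => ?_
  rw [exists_isMinimiserS_iff_of_schemeGaugeEquiv (𝒞 := sfClass d L T (C.B₃ * ε₁)) hL
    (fun u U hu huP hU => mem_sfClass_gaugeAct hu huP hU) (hE k ε₁ hε₁ hε₁a) V]
  exact exists_congr fun U => isMinimiserS_step42_iff L _ T (k + 1) V U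

end Schemes

/-! ## §2 The instance: centre-convention torus (42), guarded corner (42) and (43) carry the same slot key -/

section Instance

variable {P : Params} {N : ℕ} [NeZero N]

/-- Radii bookkeeping: if the block's largest class radius `B₃a₁` is in the (8)-radius regime then so is every `B₃ε₁`, `0 < ε₁ ≤ a₁`. [folklore] -/
theorem regime_of_le_a₁ (C : B11Thm1.Consts) (hr1 : 16 * C0 P.d * (C.B₃ * C.a₁) ≤ 3)
    (hr2 : 1024 * (P.d + 1) * (P.d + 4) * (P.L : ℝ) ^ 2 * (C.B₃ * C.a₁) ≤ 1) {ε₁ : ℝ} (hε₁ : 0 < ε₁) (hε₁a : ε₁ ≤ C.a₁) :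
    0 ≤ C.B₃ * ε₁ ∧ 16 * C0 P.d * (C.B₃ * ε₁) ≤ 3 ∧ 1024 * (P.d + 1) * (P.d + 4) * (P.L : ℝ) ^ 2 * (C.B₃ * ε₁) ≤ 1 := by
  have hB := C.B₃_pos
  have hC0 := C0_pos P.d
  have hle : C.B₃ * ε₁ ≤ C.B₃ * C.a₁ := mul_le_mul_of_nonneg_left hε₁a hB.le
  refine ⟨by positivity, ?_, ?_⟩
  · nlinarith
  · have h0 : (0 : ℝ) ≤ 1024 * (P.d + 1) * (P.d + 4) * (P.L : ℝ) ^ 2 := by positivity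
    nlinarith [mul_le_mul_of_nonneg_left hle h0]

/-- **★★ THE SLOT KEY's (T9ˢ) FOR THE CENTRE-CONVENTION TORUS (42) ⟺ FOR (43)**: for every block of constants whose largest class radius `B₃a₁` lies in the (8)-radius regime,
every data family `D`, at every depth: (9)–(10) at `lipGauge` on the collar-slot cubes for all `cstep`-constrained (8)-class minimisers ⟺ for all (43)-constrained ones
(§1 at part 16 `schemeGaugeEquiv_step42_cstep`). [cite: Balaban1985Variational, Thm 1 (9)–(10) p.279] -/
theorem reg910Slot_cstep_iff (C : B11Thm1.Consts) (hr1 : 16 * C0 P.d * (C.B₃ * C.a₁) ≤ 3)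
    (hr2 : 1024 * (P.d + 1) * (P.d + 4) * (P.L : ℝ) ^ 2 * (C.B₃ * C.a₁) ≤ 1) (T : ℕ) (D : ℕ → ℝ → Set (Site P.d → Fin P.d → (Mat N)ˣ)) :
    (∀ (k : ℕ) (ε₁ : ℝ), 0 < ε₁ → ε₁ ≤ C.a₁ → ∀ (V U : Site P.d → Fin P.d → (Mat N)ˣ), V ∈ D k ε₁ →
      IsMinimiserS P.d (fun _ => cstep P N) (sfClass P.d P.L T (C.B₃ * ε₁)) P.L T (k + 1) V U →
        ∀ x : Site P.d, Regularity (torusVP P.d P.L T (lipGauge P.d (Fin N)) (k + 1)) C.B₃ C.B₄ ε₁ U (x, P.L ^ (k + 1) - 1 + P.L ^ (k + 1) + 2)) ↔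
    (∀ (k : ℕ) (ε₁ : ℝ), 0 < ε₁ → ε₁ ≤ C.a₁ → ∀ (V U : Site P.d → Fin P.d → (Mat N)ˣ), V ∈ D k ε₁ →
      IsMinimiser P.d (sfClass P.d P.L T (C.B₃ * ε₁)) P.L T (k + 1) V U →
        ∀ x : Site P.d, Regularity (torusVP P.d P.L T (lipGauge P.d (Fin N)) (k + 1)) C.B₃ C.B₄ ε₁ U (x, P.L ^ (k + 1) - 1 + P.L ^ (k + 1) + 2)) := by
  haveI : Nonempty (Fin N) := ⟨0⟩
  exact reg910Slot_iff_of_schemeGaugeEquiv P.hL.2.le C D fun k ε₁ hε₁ hε₁a =>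
    let h := regime_of_le_a₁ (P := P) C hr1 hr2 hε₁ hε₁a
    schemeGaugeEquiv_step42_cstep (P := P) (N := N) T (k + 1) h.1 h.2.1 h.2.2

/-- **★ THE SLOT KEY's (T8) FOR THE CENTRE-CONVENTION TORUS (42) ⟺ FOR (43)** (same regime; existence of (8)-class minimisers at the data of `D`). [cite: Balaban1985Variational, Thm 1 (8) p.279] -/
theorem exists8_cstep_iff (C : B11Thm1.Consts) (hr1 : 16 * C0 P.d * (C.B₃ * C.a₁) ≤ 3)
    (hr2 : 1024 * (P.d + 1) * (P.d + 4) * (P.L : ℝ) ^ 2 * (C.B₃ * C.a₁) ≤ 1) (T : ℕ) (D : ℕ → ℝ → Set (Site P.d → Fin P.d → (Mat N)ˣ)) :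
    (∀ (k : ℕ) (ε₁ : ℝ), 0 < ε₁ → ε₁ ≤ C.a₁ → ∀ V : Site P.d → Fin P.d → (Mat N)ˣ, V ∈ D k ε₁ →
      ∃ U : Site P.d → Fin P.d → (Mat N)ˣ, IsMinimiserS P.d (fun _ => cstep P N) (sfClass P.d P.L T (C.B₃ * ε₁)) P.L T (k + 1) V U) ↔
    (∀ (k : ℕ) (ε₁ : ℝ), 0 < ε₁ → ε₁ ≤ C.a₁ → ∀ V : Site P.d → Fin P.d → (Mat N)ˣ, V ∈ D k ε₁ →
      ∃ U : Site P.d → Fin P.d → (Mat N)ˣ, IsMinimiser P.d (sfClass P.d P.L T (C.B₃ * ε₁)) P.L T (k + 1) V U) := by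
  haveI : Nonempty (Fin N) := ⟨0⟩
  exact exists8_iff_of_schemeGaugeEquiv P.hL.2.le C D fun k ε₁ hε₁ hε₁a =>
    let h := regime_of_le_a₁ (P := P) C hr1 hr2 hε₁ hε₁a
    schemeGaugeEquiv_step42_cstep (P := P) (N := N) T (k + 1) h.1 h.2.1 h.2.2

/-- **(T9ˢ) FOR ROW NE7's GUARDED CORNER (42) ⟺ FOR (43)** (part 16 `schemeGaugeEquiv_step42_gbstep`, κ = 1). [cite: Balaban1985Variational, Thm 1 (9)–(10) p.279] -/
theorem reg910Slot_gbstep_iff (C : B11Thm1.Consts) (hr1 : 16 * C0 P.d * (C.B₃ * C.a₁) ≤ 3)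
    (hr2 : 1024 * (P.d + 1) * (P.d + 4) * (P.L : ℝ) ^ 2 * (C.B₃ * C.a₁) ≤ 1) (T : ℕ) (D : ℕ → ℝ → Set (Site P.d → Fin P.d → (Mat N)ˣ)) :
    (∀ (k : ℕ) (ε₁ : ℝ), 0 < ε₁ → ε₁ ≤ C.a₁ → ∀ (V U : Site P.d → Fin P.d → (Mat N)ˣ), V ∈ D k ε₁ →
      IsMinimiserS P.d (fun _ => fun W => rescale P.L (gb P N W)) (sfClass P.d P.L T (C.B₃ * ε₁)) P.L T (k + 1) V U →
        ∀ x : Site P.d, Regularity (torusVP P.d P.L T (lipGauge P.d (Fin N)) (k + 1)) C.B₃ C.B₄ ε₁ U (x, P.L ^ (k + 1) - 1 + P.L ^ (k + 1) + 2)) ↔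
    (∀ (k : ℕ) (ε₁ : ℝ), 0 < ε₁ → ε₁ ≤ C.a₁ → ∀ (V U : Site P.d → Fin P.d → (Mat N)ˣ), V ∈ D k ε₁ →
      IsMinimiser P.d (sfClass P.d P.L T (C.B₃ * ε₁)) P.L T (k + 1) V U →
        ∀ x : Site P.d, Regularity (torusVP P.d P.L T (lipGauge P.d (Fin N)) (k + 1)) C.B₃ C.B₄ ε₁ U (x, P.L ^ (k + 1) - 1 + P.L ^ (k + 1) + 2)) := by
  haveI : Nonempty (Fin N) := ⟨0⟩
  exact reg910Slot_iff_of_schemeGaugeEquiv P.hL.2.le C D fun k ε₁ hε₁ hε₁a =>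
    let h := regime_of_le_a₁ (P := P) C hr1 hr2 hε₁ hε₁a
    schemeGaugeEquiv_step42_gbstep (P := P) (N := N) T (k + 1) h.1 h.2.1 h.2.2

/-- **(T8) FOR ROW NE7's GUARDED CORNER (42) ⟺ FOR (43).** [cite: Balaban1985Variational, Thm 1 (8) p.279] -/
theorem exists8_gbstep_iff (C : B11Thm1.Consts) (hr1 : 16 * C0 P.d * (C.B₃ * C.a₁) ≤ 3)
    (hr2 : 1024 * (P.d + 1) * (P.d + 4) * (P.L : ℝ) ^ 2 * (C.B₃ * C.a₁) ≤ 1) (T : ℕ) (D : ℕ → ℝ → Set (Site P.d → Fin P.d → (Mat N)ˣ)) :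
    (∀ (k : ℕ) (ε₁ : ℝ), 0 < ε₁ → ε₁ ≤ C.a₁ → ∀ V : Site P.d → Fin P.d → (Mat N)ˣ, V ∈ D k ε₁ →
      ∃ U : Site P.d → Fin P.d → (Mat N)ˣ, IsMinimiserS P.d (fun _ => fun W => rescale P.L (gb P N W)) (sfClass P.d P.L T (C.B₃ * ε₁)) P.L T (k + 1) V U) ↔
    (∀ (k : ℕ) (ε₁ : ℝ), 0 < ε₁ → ε₁ ≤ C.a₁ → ∀ V : Site P.d → Fin P.d → (Mat N)ˣ, V ∈ D k ε₁ →
      ∃ U : Site P.d → Fin P.d → (Mat N)ˣ, IsMinimiser P.d (sfClass P.d P.L T (C.B₃ * ε₁)) P.L T (k + 1) V U) := by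
  haveI : Nonempty (Fin N) := ⟨0⟩
  exact exists8_iff_of_schemeGaugeEquiv P.hL.2.le C D fun k ε₁ hε₁ hε₁a =>
    let h := regime_of_le_a₁ (P := P) C hr1 hr2 hε₁ hε₁a
    schemeGaugeEquiv_step42_gbstep (P := P) (N := N) T (k + 1) h.1 h.2.1 h.2.2

end Instance

end

end Summit.QuantumFields.YangMills.BalabanUVNodes.N16SlotKeySchemeInvariance
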